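import Literature.AlgebraicGeometry.Resolution.FiniteBirationalNormal
import Literature.AlgebraicGeometry.Resolution.AlterationsProofs
import Mathlib.AlgebraicGeometry.ZariskisMainTheorem
import HarnessLib

/-!
# Birational morphisms onto a normal open: local isomorphism statements

Topic: `Literature/AlgebraicGeometry/Resolution`. Two local forms of "a finite birational
morphism onto a normal scheme is an isomorphism" used in the proof of de Jong 1996, Lemma 4.20:

> "The proper morphism `pr₂` has a finite fibre at `x`, hence there exists an open neighbourhood
> `V ⊂ X` of `x` such that `pr₂⁻¹(V) → V` is finite, 2.7. The morphism `T → X` is birational,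
> hence `pr₂⁻¹(V) → V` is a finite modification. If `x` lies in the smooth locus of `f : X → S`,
> […] then `x` is a normal point of `X`, as `S` is normal. In this case we may assume that `V` is
> normal. Thus the finite birational morphism `pr₂⁻¹(V) → V` is an isomorphism." (p. 73)

* `exists_isIso_morphismRestrict_of_finite_preimage_singleton`: for a proper birational
  morphism `g : T → Y` of integral schemes, an open `V₀ ⊆ Y` all of whose local rings are
  integrally closed and `y ∈ V₀` with finite fibre `g⁻¹(y)`, `g` is an isomorphism over an open
  neighbourhood of `y` (2.7 is Mathlib's `exists_isFinite_morphismRestrict_of_finite_preimage_singleton`,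
  Stacks 02UP, a corollary of Zariski's Main Theorem);
* `exists_isOpenImmersion_of_quasiFiniteAt`: the pointwise variant — if `g` is separated of
  finite type and birational and `t ∈ g⁻¹(V₀)` is isolated in its fibre, then `g` restricted to
  an open neighbourhood of `t` is an open immersion (Zariski's Main Theorem in Grothendieck's form,
  Mathlib `IsOpenImmersion (g.quasiFiniteLocus.ι ≫ g.toNormalization)`, Stacks 03GW, and the
  relative normalisation `g.fromNormalization` is an isomorphism over `V₀`).

Both rest on `isIso_morphismRestrict_of_isIntegralHom_of_normal`: an integral dominant morphism
of integral schemes inducing an isomorphism of function fields is an isomorphism over every open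
with integrally closed local rings (`FiniteBirationalNormal.lean`).

## References

* A. J. de Jong, *Smoothness, semi-stability and alterations*, Publ. Math. IHÉS 83 (1996), 2.7
  and proof of Lemma 4.20, pp. 54, 73.
* The Stacks Project, Tags 02UP, 03GW, 0AB1.
-/

noncomputable section

open CategoryTheory CategoryTheory.Limits AlgebraicGeometry TopologicalSpace Topology

namespace Literature.AlgebraicGeometry.Resolution

universe u

/-! ## Integral + birational is an isomorphism over every normal open -/

/-- The local rings of an open subscheme are those of the ambient scheme. [folklore] -/
theorem isIntegrallyClosed_stalk_opens {Y : Scheme.{u}} (V : Y.Opens)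
    (hV : ∀ y ∈ V, IsIntegrallyClosed (Y.presheaf.stalk y)) (v : V) :
    IsIntegrallyClosed ((V : Scheme.{u}).presheaf.stalk v) := by
  have h : IsIntegrallyClosed (Y.presheaf.stalk (V.ι v)) := hV _ (by simp)
  exact IsIntegrallyClosed.of_equiv (asIso (V.ι.stalkMap v)).commRingCatIsoToRingEquiv

/-- The stalk map of a restriction `f ∣_ V` at the generic point is an isomorphism when that of
`f` is. [folklore] -/
theorem isIso_stalkMap_morphismRestrict_genericPoint {X Y : Scheme.{u}} [IsIntegral X]
    (f : X ⟶ Y) (hstalk : IsIso (f.stalkMap (genericPoint X))) (V : Y.Opens)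
    [Nonempty (f ⁻¹ᵁ V)] :
    haveI : IsIntegral (f ⁻¹ᵁ V) := isIntegral_of_isOpenImmersion (f ⁻¹ᵁ V).ι
    IsIso ((f ∣_ V).stalkMap (genericPoint (f ⁻¹ᵁ V))) := by
  haveI : IsIntegral (f ⁻¹ᵁ V) := isIntegral_of_isOpenImmersion (f ⁻¹ᵁ V).ι
  have hη : (f ⁻¹ᵁ V).ι (genericPoint (f ⁻¹ᵁ V)) = genericPoint X :=
    genericPoint_eq_of_isOpenImmersion (f ⁻¹ᵁ V).ι
  have h1 : IsIso (f.stalkMap ((genericPoint (f ⁻¹ᵁ V) : (f ⁻¹ᵁ V : X.Opens)).1)) := by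
    have : ((genericPoint (f ⁻¹ᵁ V) : (f ⁻¹ᵁ V : X.Opens)).1) = genericPoint X := hη
    rw [this]; exact hstalk
  exact ((MorphismProperty.isomorphisms CommRingCat).arrow_mk_iso_iff
    (morphismRestrictStalkMap f V (genericPoint (f ⁻¹ᵁ V)))).mpr
      ((MorphismProperty.isomorphisms.iff _).mpr h1)

/-- **An integral dominant morphism of integral schemes inducing an isomorphism of function
fields is an isomorphism over every open all of whose local rings are integrally closed** (the
local form of "finite birational onto normal is an isomorphism", de Jong 1996, 4.16/4.20/4.21):
over each non-empty affine open of such a `V` this is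
`isIso_morphismRestrict_of_isIntegralHom_of_isIso_stalkMap`. [cite: DeJong1996, proof of Lemma 4.20, p. 73] -/
theorem isIso_morphismRestrict_of_isIntegralHom_of_normal {X Y : Scheme.{u}} [IsIntegral X]
    [IsIntegral Y] (f : X ⟶ Y) [IsIntegralHom f] [IsDominant f]
    (hstalk : IsIso (f.stalkMap (genericPoint X))) (V : Y.Opens)
    (hV : ∀ y ∈ V, IsIntegrallyClosed (Y.presheaf.stalk y)) : IsIso (f ∣_ V) := by
  rcases isEmpty_or_nonempty V with hVe | hVne
  · infer_instance
  -- the restriction `f⁻¹(V) → V` is an integral dominant morphism of integral schemes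
  haveI : IsDominant (f ∣_ V) := IsZariskiLocalAtTarget.restrict ‹IsDominant f› V
  haveI : Nonempty (f ⁻¹ᵁ V) := by
    obtain ⟨v⟩ := hVne
    obtain ⟨x⟩ := (f ∣_ V).denseRange.nonempty_iff.mpr ⟨v⟩
    exact ⟨x⟩
  haveI : IsIntegral (f ⁻¹ᵁ V) := isIntegral_of_isOpenImmersion (f ⁻¹ᵁ V).ι
  haveI : IsIntegral V := isIntegral_of_isOpenImmersion V.ι
  have hstalk' := isIso_stalkMap_morphismRestrict_genericPoint f hstalk V
  have hV' : ∀ v : V, IsIntegrallyClosed ((V : Scheme.{u}).presheaf.stalk v) :=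
    isIntegrallyClosed_stalk_opens V hV
  -- hence an isomorphism over every non-empty affine open of `V`, hence an isomorphism
  have key : MorphismProperty.isomorphisms Scheme (f ∣_ V) := by
    refine (IsZariskiLocalAtTarget.iff_of_iSup_eq_top
      (P := MorphismProperty.isomorphisms Scheme) _ (iSup_nonempty_affineOpens_eq_top V)).mpr ?_
    rintro ⟨W, hWne⟩
    show IsIso ((f ∣_ V) ∣_ (W : (V : Scheme.{u}).Opens))
    haveI := hWne
    exact isIso_morphismRestrict_of_isIntegralHom_of_isIso_stalkMap (f ∣_ V) hV' hstalk' W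
  exact key

/-- Variant of `isIntegrallyClosed_stalk_opens` for a single point. [folklore] -/
theorem isIntegrallyClosed_stalk_opens_of {Y : Scheme.{u}} (V : Y.Opens) (v : V)
    (h : IsIntegrallyClosed (Y.presheaf.stalk (V.ι v))) :
    IsIntegrallyClosed ((V : Scheme.{u}).presheaf.stalk v) :=
  IsIntegrallyClosed.of_equiv (asIso (V.ι.stalkMap v)).commRingCatIsoToRingEquiv

/-- The preimage of a non-empty open under a dominant morphism is non-empty. [folklore] -/
theorem nonempty_preimage_of_isDominant {X Y : Scheme.{u}} (f : X ⟶ Y) [IsDominant f]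
    (V : Y.Opens) [hV : Nonempty V] : Nonempty (f ⁻¹ᵁ V) := by
  haveI : IsDominant (f ∣_ V) := IsZariskiLocalAtTarget.restrict ‹IsDominant f› V
  obtain ⟨v⟩ := hV
  obtain ⟨x⟩ := (f ∣_ V).denseRange.nonempty_iff.mpr ⟨v⟩
  exact ⟨x⟩

/-! ## de Jong 1996, 2.7 with 4.20: finite fibre over a normal point ⇒ isomorphism nearby -/

/-- **A proper birational morphism is an isomorphism near a normal point with finite fibre**
(de Jong 1996, 2.7 and the proof of 4.20: "The proper morphism `pr₂` has a finite fibre at `x`,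
hence there exists an open neighbourhood `V ⊂ X` of `x` such that `pr₂⁻¹(V) → V` is finite,
2.7. […] we may assume that `V` is normal. Thus the finite birational morphism `pr₂⁻¹(V) → V`
is an isomorphism"). For `g : T → Y` proper and birational between integral schemes, `V₀ ⊆ Y`
open with integrally closed local rings, and `y ∈ V₀` with `g⁻¹(y)` finite, there is an open
`V ∋ y` with `g⁻¹(V) → V` an isomorphism. The neighbourhood over which `g` is finite is
Mathlib's `exists_isFinite_morphismRestrict_of_finite_preimage_singleton` (Stacks 02UP).
[cite: DeJong1996, 2.7 and proof of Lemma 4.20, pp. 54, 73] -/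
theorem exists_isIso_morphismRestrict_of_finite_preimage_singleton {T Y : Scheme.{u}}
    [IsIntegral T] [IsIntegral Y] (g : T ⟶ Y) [IsProper g] (hg : IsBirational g)
    (V₀ : Y.Opens) (hV₀ : ∀ y ∈ V₀, IsIntegrallyClosed (Y.presheaf.stalk y)) {y : Y}
    (hy : y ∈ V₀) (hfin : (g ⁻¹' {y}).Finite) :
    ∃ V : Y.Opens, y ∈ V ∧ IsIso (g ∣_ V) := by
  obtain ⟨V₁, hy₁, hfin₁⟩ := exists_isFinite_morphismRestrict_of_finite_preimage_singleton g y hfin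
  haveI := hfin₁
  haveI : IsDominant g := hg.isDominant
  have hstalk : IsIso (g.stalkMap (genericPoint T)) := hg.isIso_stalkMap_genericPoint
  haveI : Nonempty V₁ := ⟨⟨y, hy₁⟩⟩
  haveI : IsDominant (g ∣_ V₁) := IsZariskiLocalAtTarget.restrict ‹IsDominant g› V₁
  haveI : Nonempty (g ⁻¹ᵁ V₁) := nonempty_preimage_of_isDominant g V₁
  haveI : IsIntegral (g ⁻¹ᵁ V₁) := isIntegral_of_isOpenImmersion (g ⁻¹ᵁ V₁).ι
  haveI : IsIntegral V₁ := isIntegral_of_isOpenImmersion V₁.ι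
  have hstalk₁ := isIso_stalkMap_morphismRestrict_genericPoint g hstalk V₁
  have h := isIso_morphismRestrict_of_isIntegralHom_of_normal (g ∣_ V₁) hstalk₁ (V₁.ι ⁻¹ᵁ V₀)
    (fun v hv => isIntegrallyClosed_stalk_opens_of V₁ v (hV₀ _ hv))
  -- `g ∣_{V₁} ∣_{V₁ ∩ V₀} ≅ g ∣_{V₁ ∩ V₀}`
  have h2 : IsIso (g ∣_ (V₁.ι ''ᵁ (V₁.ι ⁻¹ᵁ V₀))) :=
    ((MorphismProperty.isomorphisms Scheme).arrow_mk_iso_iff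
      (morphismRestrictRestrict g V₁ (V₁.ι ⁻¹ᵁ V₀))).mp h
  have hV : V₁.ι ''ᵁ (V₁.ι ⁻¹ᵁ V₀) = V₁ ⊓ V₀ := by
    rw [Scheme.Hom.image_preimage_eq_opensRange_inf, Scheme.Opens.opensRange_ι]
  refine ⟨V₁ ⊓ V₀, ⟨hy₁, hy⟩, ?_⟩
  exact ((MorphismProperty.isomorphisms Scheme).arrow_mk_iso_iff (morphismRestrictEq g hV)).mp h2

/-- In the same situation the fibre `g⁻¹(y)` is a single point. [folklore] -/
theorem subsingleton_preimage_singleton_of_finite {T Y : Scheme.{u}} [IsIntegral T]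
    [IsIntegral Y] (g : T ⟶ Y) [IsProper g] (hg : IsBirational g) (V₀ : Y.Opens)
    (hV₀ : ∀ y ∈ V₀, IsIntegrallyClosed (Y.presheaf.stalk y)) {y : Y} (hy : y ∈ V₀)
    (hfin : (g ⁻¹' {y}).Finite) : (g ⁻¹' {y}).Subsingleton := by
  obtain ⟨V, hyV, hiso⟩ := exists_isIso_morphismRestrict_of_finite_preimage_singleton g hg V₀ hV₀
    hy hfin
  haveI := hiso
  intro a ha b hb
  have hinj : Function.Injective (g ∣_ V) := (g ∣_ V).homeomorph.injective
  have ha' : a ∈ g ⁻¹ᵁ V := by show g a ∈ V; rw [show g a = y from ha]; exact hyV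
  have hb' : b ∈ g ⁻¹ᵁ V := by show g b ∈ V; rw [show g b = y from hb]; exact hyV
  have key : (g ∣_ V) ⟨a, ha'⟩ = (g ∣_ V) ⟨b, hb'⟩ := by
    apply Subtype.ext
    rw [morphismRestrict_base_coe, morphismRestrict_base_coe]
    exact ha.trans hb.symm
  exact congrArg Subtype.val (hinj key)

/-! ## Zariski's Main Theorem form: an isolated point of a fibre has an open-immersion neighbourhood -/

/-- **Birational, quasi-finite at `t`, normal near `g t` ⇒ open immersion near `t`** (a local form
of Zariski's Main Theorem, Stacks 03GW with 0AB1). Let `g : T → Y` be a separated quasi-compact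
morphism locally of finite type between integral schemes which is birational, `V₀ ⊆ Y` an open
all of whose local rings are integrally closed, and `t ∈ g⁻¹(V₀)` a point isolated in its fibre
(`g.QuasiFiniteAt t`). Then some open neighbourhood `Ω` of `t` maps isomorphically onto an open
of `Y`. Proof: by Mathlib's form of Zariski's Main Theorem the quasi-finite locus `Ω₀ ∋ t` of
`g` embeds openly into the relative normalisation `Y' → Y` of `Y` in `T`; `Y'` is integral,
`Y' → Y` is integral, dominant and an isomorphism on function fields (it is so after composing
with the open immersion `Ω₀ → Y'`, as `g` is birational), hence an isomorphism over the normal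
open `V₀` (`isIso_morphismRestrict_of_isIntegralHom_of_normal`); take `Ω = Ω₀ ∩ g⁻¹(V₀)`.
[cite: StacksProject, Tag 03GW] -/
theorem exists_isOpenImmersion_of_quasiFiniteAt {T Y : Scheme.{u}} [IsIntegral T]
    [IsIntegral Y] (g : T ⟶ Y) [IsSeparated g] [LocallyOfFiniteType g] [QuasiCompact g]
    (hg : IsBirational g) (V₀ : Y.Opens) (hV₀ : ∀ y ∈ V₀, IsIntegrallyClosed (Y.presheaf.stalk y))
    {t : T} (ht : g t ∈ V₀) (hq : g.QuasiFiniteAt t) :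
    ∃ Ω : T.Opens, t ∈ Ω ∧ IsOpenImmersion (Ω.ι ≫ g) := by
  haveI : IsDominant g := hg.isDominant
  set ι := g.toNormalization with hιdef
  set ν := g.fromNormalization with hνdef
  have hιν : ι ≫ ν = g := g.toNormalization_fromNormalization
  haveI : IsDominant ν := by
    have : IsDominant (ι ≫ ν) := by rw [hιν]; infer_instance
    exact IsDominant.of_comp ι ν
  set Ω₀ := g.quasiFiniteLocus with hΩ₀def
  have htΩ₀ : t ∈ Ω₀ := hq
  have hoi : IsOpenImmersion (Ω₀.ι ≫ ι) := inferInstance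
  -- the stalk map of `ν` at the generic point of the normalisation is an isomorphism
  have hstalkν : IsIso (ν.stalkMap (genericPoint g.normalization)) := by
    have hgη : IsIso (g.stalkMap (genericPoint T)) := hg.isIso_stalkMap_genericPoint
    have hηΩ : genericPoint T ∈ Ω₀ :=
      ((genericPoint_spec T).mem_open_set_iff Ω₀.isOpen).mpr ⟨t, Set.mem_univ _, htΩ₀⟩
    have h1 : IsIso (ι.stalkMap (genericPoint T)) := by
      have h2 : IsIso ((Ω₀.ι ≫ ι).stalkMap ⟨genericPoint T, hηΩ⟩) := inferInstance
      have h2' : IsIso (Ω₀.ι.stalkMap ⟨genericPoint T, hηΩ⟩) := inferInstance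
      rw [Scheme.Hom.stalkMap_comp] at h2
      exact @IsIso.of_isIso_comp_right _ _ _ _ _ _ _ h2' h2
    have h3 : IsIso ((ι ≫ ν).stalkMap (genericPoint T)) := by rw [hιν]; exact hgη
    rw [Scheme.Hom.stalkMap_comp] at h3
    have h4 : IsIso (ν.stalkMap (ι (genericPoint T))) :=
      @IsIso.of_isIso_comp_right _ _ _ _ _ _ _ h1 h3
    rwa [genericPoint_eq_of_isDominant ι] at h4
  -- hence `ν` is an isomorphism over the normal open `V₀`
  have hν : IsIso (ν ∣_ V₀) := isIso_morphismRestrict_of_isIntegralHom_of_normal ν hstalkν V₀ hV₀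
  -- the open neighbourhood `Ω = Ω₀ ∩ g⁻¹(V₀)` of `t`
  let Ω : T.Opens := Ω₀ ⊓ g ⁻¹ᵁ V₀
  refine ⟨Ω, ⟨htΩ₀, ht⟩, ?_⟩
  have hΩι : IsOpenImmersion (Ω.ι ≫ ι) := by
    have : Ω.ι ≫ ι = T.homOfLE (inf_le_left : Ω ≤ Ω₀) ≫ Ω₀.ι ≫ ι := by
      rw [← Category.assoc, Scheme.homOfLE_ι]
    rw [this]
    infer_instance
  have hrange : Set.range (Ω.ι ≫ ι) ⊆ Set.range (ν ⁻¹ᵁ V₀).ι := by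
    rw [Scheme.Opens.range_ι]
    rintro _ ⟨x, rfl⟩
    show ν ((Ω.ι ≫ ι) x) ∈ V₀
    rw [← Scheme.Hom.comp_apply, Category.assoc, hιν, Scheme.Hom.comp_apply]
    exact x.2.2
  let k := IsOpenImmersion.lift (ν ⁻¹ᵁ V₀).ι (Ω.ι ≫ ι) hrange
  have hk : k ≫ (ν ⁻¹ᵁ V₀).ι = Ω.ι ≫ ι := IsOpenImmersion.lift_fac _ _ _
  haveI : IsOpenImmersion k := by
    have : IsOpenImmersion (k ≫ (ν ⁻¹ᵁ V₀).ι) := by rw [hk]; exact hΩι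
    exact IsOpenImmersion.of_comp k (ν ⁻¹ᵁ V₀).ι
  have hfac : Ω.ι ≫ g = k ≫ (ν ∣_ V₀) ≫ V₀.ι := by
    rw [morphismRestrict_ι, ← Category.assoc, hk, Category.assoc, hιν]
  rw [hfac]
  haveI := hν
  infer_instance

end Literature.AlgebraicGeometry.Resolution

end
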